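import Mathlib
import HarnessLib
import HarnessLib.Audit
import Summits.AnomalousDissipation.Statement
import Literature.Analysis.FluidPDE.TorusClassicalLerayHopf
import Literature.Analysis.FluidPDE.TorusClassicalLerayHopfProofs
import HarnessLib.Audit.Status.Attr

/-!
Route: HopfSnake

DORMANT since 2026-08-22T06:43:24Z (reconciler: no traction for 5.1 d (last activity statement-grounded at 2026-08-17T02:45:17Z); parked, not closed — `ledger route dormant route-AnomalousDissipation-HopfSnake --off` to reactivate) — unstaffed, not closed; items shared with open routes are served there. `ledger route dormant <id> --off` reactivates.

# Route HopfSnake — AnomalousDissipation (Literature.Turb.ZerothLaw); realises idea card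
follow-the-snake-global-hopf-viscosity-axis

## Thesis X (words)
FOLLOW THE SNAKE. For some smooth steady divergence-free mean-zero force f on T³ there is a
VISCOSITY SNAKE that is bounded and loud:
a continuous one-parameter family s ↦ (ν(s), u(s)) (s ∈ ℝ) of mean-zero, time-periodic,
energetically non-stationary
(t ↦ ½∫|u(s,t)|² not constant: neither steady states nor travelling waves) classical solutions of
NS_{ν(s)} forced by f, which
reaches ν → 0⁺ (inf_s ν(s) = 0) without dying at positive viscosity (periods and enstrophies bounded
on every {s : ν(s) ≥ ν₁}, ν₁ > 0),
whose limsup-mean energies ⟨‖u(s)‖²⟩ are bounded uniformly in s, and whose mean dissipation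
ν(s)⟨‖∇u(s)‖²⟩ stays ≥ ε > 0 at
arbitrarily small ν(s). Such families are what global Hopf bifurcation (Fuller index /
Alexander–Yorke / Mallet-Paret–Yorke snakes /
Fiedler's index for parabolic systems) produces when the bifurcation parameter is the viscosity: a
snake of periodic orbits born at a
Hopf point of the steady variety can only (a) return to the steady variety with cancelling indices,
(b) blow up its (virtual) period at
some ν₁ > 0, (c) blow up its norm at some ν₁ > 0, or (d) reach the inviscid shore ν = 0⁺; X asserts
a bounded loud (d)-snake.

## Thesis X in Lean = decl BoundedLoudSnake (target, rank 0; elaborates rc 0; fully qualified in the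
route file)
Lean: ∃ f, IsSmooth f ∧ IsDivFree f ∧ HasZeroMean f ∧ ∃ (ν : ℝ → ℝ) (u : ℝ → ℝ → T³ → E³) (p : ℝ → ℝ
→ T³ → ℝ), (Continuous ν ∧ Continuous (fun (s,t,x) => u s t x) ∧ (∀ s, 0 < ν s ∧
IsClassicalNSSolutionOn univ (ν s) (fun _ => f) (u s) (p s) ∧ (∀ t, HasZeroMean (u s t)) ∧ (∃ T > 0,
Periodic (u s) T) ∧ (∃ t, kineticEnergy (u s t) ≠ kineticEnergy (u s 0))) ∧ (∀ ν₀ > 0, ∃ s, ν s <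
ν₀) ∧ (∀ ν₁ > 0, ∃ M, ∀ s, ν₁ ≤ ν s → (∃ T, 0 < T ≤ M ∧ Periodic (u s) T) ∧ ∀ t, gradNormSq (u s t)
≤ M)) ∧ (∃ E, ∀ s, meanEnergy (u s) ≤ E) ∧ ∃ ε > 0, ∀ ν₀ > 0, ∃ s, ν s < ν₀ ∧ ε ≤ meanDissipation (ν
s) (u s)

## Deciding theorem and assembly (rev 3–4, 2026-08-15)
DECIDING THEOREM (certified, gate-native, axioms propext/Classical.choice/Quot.sound): closes :
BoundedLoudSnake → AnomalousDissipation —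
choose s_j with ν(s_j) < 1/(j+1) and mean dissipation ≥ ε, squeeze ν_j → 0, and each u(s_j) is a
global Leray–Hopf solution from its own
datum u(s_j)(0) by the DISCHARGED Literature fact Torus.isGlobalLerayHopf_of_isClassicalNSSolutionOn
(proof
Torus.isGlobalLerayHopf_of_isClassicalNSSolutionOn_holds / IsClassicalNSSolutionOn.isGlobalLerayHopf
in TorusClassicalLerayHopfProofs, used
inside the proof, not assumed); the snake's tail is a CoherentStates witness (stmt-0218) with a
provenance.
CRUXES ⇒ X: Assembly = BoundedSnakeToZero3D → BoundedSnakesAreLoud3D → AnomalousDissipation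
(instantiate the loudness crux on the bounded
(d)-snake of a genuinely three-dimensional force to get X = BoundedLoudSnake, then closes; pure
logic, planner sketch Sketch3D.lean rc 0).
GENUINELY THREE-DIMENSIONAL FORCE (side condition introduced at rev 4 after the refuters' planar
objection): f has no continuous translation
symmetry, ∀ k ≠ 0 ∃ τ x, f(x + proj(τ•k)) ≠ f(x) — f does not factor through a 2-torus quotient in
any (possibly oblique) direction; this
removes exactly the x₃-independent (planar / 2.5-D) sector governed by the proved barrier
AlexakisDoering2006_energyDissipationBound, and since
a solution invariant under a one-parameter translation group forces f to be invariant too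
(difference of shifted momentum equations: the
pressure difference is harmonic on T³), no snake of such an f lives in a planar invariant subspace.
Generic f, Taylor–Green and Kida forcings
qualify; Kolmogorov/shear forcings do not (their snakes belong to the planar calibration, not to
this route).

Rationale: WHY THIS LINE. Bifurcation/degree theory imported into the summit (sources Fiedler1988 [LNM 1309,
read pp.13-14,25-29,32-36],
AlexanderYorke1978, ChowMalletParetYorke1978, ChowMalletParet1978, MalletParetYorke1982,
YorkeAlligood1983; NS side Sattinger1971,
Iooss1972, ChenPrice1996, ArioliKoch2021 [arXiv:2009.12762 read pp.1-2], VanVeenKidaKawahara2006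
[arXiv:1804.00547 read pp.6-7],
BergBredenLessardVeen2021). The summit's quantifiers are existential (∃ν_j ∃u_j for ONE fixed f);
the only tool that manufactures
periodic solutions of a dissipative PDE far from every perturbative regime, with no stability,
hyperbolicity or smallness, is
index continuation: Fiedler's analytic-semigroup form of global Hopf bifurcation (Thm 2.10 + Cor
2.13 + Rem 2.11) applies to
d_t u = -νAu - B(u,u) + f on L²_σ(T³) (A Stokes, compact resolvent, B smooth X^ω → X for ω > 3/4)
with λ = log(1/ν) as parameter and
gives, from every steady centre of non-zero index, a continuum of periodic orbits that is unbounded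
in (λ, ‖u‖_{X^ω}) or has
unbounded virtual periods. Read on the viscosity axis this is a four-exit census for every snake:
(a) return with cancelling
indices, (b) period blow-up at ν₁ > 0 (homoclinic/cascade end), (c) norm blow-up at ν₁ > 0 (a
periodic-solution regularity
statement), (d) ν → 0⁺. Rigorous Hopf points in ν now exist (ArioliKoch2021, CAP, planar; the
Kida-forced box has a numerical one
at ν ≈ 0.01, VKK2006 p.6) and UPO continuation in ν is routine numerically (VKK2006 p.7: half the
branches end at bifurcation
points = exits (a)/(b) observed). The route bets that at least one (d)-snake exists, stays O(1) in
energy and stays loud; its tail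
is then a CoherentStates witness with a provenance (continuously connected to moderate viscosity);
the deciding theorem
closes : BoundedLoudSnake → AnomalousDissipation is certified (rev 3) and the Assembly (cruxes ⇒ X ⇒
summit) is pure logic.
RANKED CRUXES. #2 SnakeToZero (the milestone the engine must deliver: a (d)-snake of energetically
non-stationary mean-zero
periodic classical solutions for one f; new theorem-shaped claim — no periodic orbit of steadily
forced NS is known rigorously at
two viscosities). #3 BoundedSnakesAreLoud3D (universal over GENUINELY THREE-DIMENSIONAL forces — no
continuous translation symmetry of f:
bounded (d)-snakes cannot laminarise in injection; the physics crux, in the form that makes the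
assembly pure instantiation; refutable by
ONE bounded quiet snake of a 3-D force; rev-4 restatement of stmt-1800 after the refuter objection
that the x₃-independent sector, where
AlexakisDoering2006 forces ε ≲ U^{5/2}ν^{1/2}, made the unrestricted statement
true-only-if-vacuous). #4 BoundedSnakeToZero3D (selection, for a
genuinely 3-D f: some (d)-snake escapes the laminar scaling E ~ ν⁻²; rev-4 restatement of stmt-1801
matching #3). Target BoundedLoudSnake
(rank 0) = #4 ∧ loud, unchanged, and reached INSIDE the route by the glue support item LoudSnakeGlue
: BoundedSnakeToZero3D →
BoundedSnakesAreLoud3D → BoundedLoudSnake (pure instantiation, planner sketch rc 0; added 2026-08-16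
answering the gate's
route.target-unreachable hold, option (a)); other support: PeriodicOrbitsEnstrophyBound
(exit (c) as the precise conditional-regularity input, typed), GlobalHopfAlternativeNS (the engine,
informal until the linearised
NS operator / crossing numbers are defined in Literature — definition requested).
TYPING CHOICES. The snake is typed elementarily (continuity of ν and joint continuity of (s,t,x) ↦
u, no function-space topology,
no minimal periods: 'some period ≤ M' survives flip doublings); 'energetically non-stationary'
excludes travelling waves, which for
x₁-invariant forces are steady states in a Galilean frame (Fiedler Thm 2.9 gives them unbounded
continua with NO period exit) and
belong to the steady routes (CoherentStates 0219, cards stokes-curve…, galilean-drift…).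
KILL CRITERIA. (i) A theorem 'for every smooth f every snake of NS_ν(f) has ν bounded below' (all
snakes die at positive viscosity)
closes the route; (ii) BoundedSnakesAreLoud3D refuted by a bounded quiet snake of a genuinely 3-D
force ⇒ close, unless the witness is a
small perturbation of a planar snake, in which case pivot ONCE to a named force class (Taylor–Green
/ Kida high-symmetric forcing); the planar
restatement foreseen here at open was carried out at rev 4; (iii) PeriodicOrbits-
EnstrophyBound refuted at some ν > 0 ⇒ exit (c) is real and SnakeToZero must carry it as hypothesis
(conditional route).
NOT DECOMPOSED YET (depth is earned after #2 is grounded): the engine's pieces — (F1)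
uniqueness/global stability for ν > ν_c(f)
(orients snakes downward), local Hopf at a certified centre for a chosen 3-D force
(Kida/Taylor–Green, where the primary instability
IS a Hopf point, unlike Kolmogorov forcing whose primary instability is steady, MeshalkinSinai1961),
index bookkeeping (net escaping
snake-ends = net Hopf spectral flow), certified continuation of one snake over a decade of ν (kit,
radii-polynomial à la
BergBredenLessardVeen2021) recording (period, E, ε, orbit index); symmetric forces via Fiedler's
equivariant index (relative periodic
orbits). No catalogue item of the prior programme is reused.
CHEAPEST FALSIFIER. Numerical, then certified, continuation in ν of ONE snake of the Taylor–Green-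
or Kida-forced box over a decade of ν
(VanVeenKidaKawahara2006 set-up, arXiv:1804.00547 pp.6–7; radii polynomials à la
BergBredenLessardVeen2021, arXiv:1902.00384) recording
(period, E, ε, orbit index): if every branch followed ends at a bifurcation point or blows up its
period/enstrophy at moderate ν, exits (a)–(c)
dominate and the bet is weak; a branch running to the resolution limit with E = O(1) and ε ≈ const
is the first (d)-segment. Theorem-level kill:
'for an open set of smooth f every snake of NS_ν(f) has ν bounded below' (kill criterion (i));
lookup-level kill: a 2-D/planar counterexample no
longer touches the route (rev 4), only a genuinely 3-D quiet bounded snake does.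

Novelty: NOVELTY (searched 2026-08-15 BEFORE this claim; searchd local index was down (rc 75) all session,
so: `lit search --source crossref` x7 queries, `lit search --source arxiv` x2 (ERR), `lit galaxy
search --star all` ("global Hopf bifurcation": 40 rows — delay eqs, reaction networks, economics,
Ize–Vignoli equivariant degree; "oriented families of periodic orbits": Fiedler LNM 1309,
Ize–Massabo–Vignoli), hub cards/routes/negatives, held texts READ: Fiedler1988 =
panama:278640298295307 pp.13–14, 25–29, 32–36; ArioliKoch2021 = arXiv:2009.12762 pp.1–2;
VanVeenKidaKawahara2006 = arXiv:1804.00547 pp.6–7).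
Nearest prior art actually found:
(i) THE ENGINE, abstract/ODE/reaction–diffusion only: AlexanderYorke1978 (doi:10.2307/2373851),
ChowMalletParetYorke1978 (doi:10.1016/0362-546x(78)90017-2), ChowMalletParet1978 (Fuller index,
doi:10.1016/0022-0396(78)90041-4), MalletParetYorke1982 (snakes, doi:10.1016/0022-0396(82)90085-7),
Fiedler1985 (doi:10.1515/crll.1985.359.1), Fiedler1988 (doi:10.1007/bfb0082943: Thm 2.10 'global =
unbounded in Λ×X or arbitrarily large virtual periods', Cor 2.13 analytic semigroups, Rem 2.11 open
sub-regions; applications §8: coupled oscillators, reaction–diffusion — no fluids), recent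
equivariant-degree versions doi:10.2139/ssrn.4578932 (2023) and doi:10.1090/surv/286/16 (2025).
(ii) HOPF FOR NAVIER–STOKES, ALL LOCAL: Sattinger1971 (doi:10.1007/bf00250178), Iooss1972
(doi:10.1007/bf00281637), JosephSattinger1972, ChenPrice1996 (doi:10.1007/bf02100098, Kolmogo  [refs: 10.2307/2373851, 10.1016/0362-546x(78, 10.1016/0022-0396(78, 10.1016/0022-0396(82, 10.1515/crll.1985.359.1, 10.1007/bfb0082943:, 10.2139/ssrn.4578932, 10.1090/surv/286/16, 10.1007/bf00250178, 10.1007/bf00281637, 10.1007/bf02100098, 10.1007/s00205-016-1001-3, 10.1016/j.jmaa.2024.128399, 10.1007/s00021-021-00592-0, 10.12775/tmna.1999.015, 10.1016/j.jcp.2004.04.018, 2009.12762, 1804.00547, 1902.00384]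

Barriers (technique_class: global-hopf-bifurcation fuller-index snakes upo-continuation): technique_class: global-hopf-bifurcation fuller-index snakes upo-continuation
Literature.Barriers.AnomalousDissipation.BrueDeLellis2023_noAnomaly_beforeEulerSingularity: blocks
anomaly on finite windows [0,T] from FIXED smooth data with ν-independent force before the Euler
solution from that datum breaks down. Evaded by the summit's own long-time form used here: witnesses
are eternal time-periodic solutions measured by period (= limsup) means; their data u(s)(0) move
with ν(s) and need not converge to any datum, so no common Euler lifespan exists (same evasion as
route CoherentStates).
Literature.Barriers.AnomalousDissipation.BrenierDeLellisSzekelyhidi2011_cor1: measure-valued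
weak–strong uniqueness kills anomaly for data converging strongly to a datum with a classical Euler
solution on its lifespan — again no common datum and no finite window here; not engaged.
Literature.Barriers.AnomalousDissipation.Cheskidov2023_thm13_not_forceRobustNoAnomaly: refutes
NEGATIVE statements provable by force-robust energy methods. Our only universal item
(BoundedSnakesAreLoud) is a LOWER bound on dissipation for exact solutions of the fixed-force
autonomous equation; moreover the snake structure is destroyed by any time-dependent perturbation of
f (autonomy and the S¹-action are essential), so nothing here is force-robust and nothing here could
be transplanted into the blocked class. Not engaged.
Literature.Barriers.AnomalousDissipation.DrivasEyink2019_lemma1: uniform L³_t B^{σ}_{3,∞}, σ > 1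

Novelty grade: new-combination — Route review grade (refuter, 2026-08-15). Nearest prior art = the planner's own list, spot-checked this session (crossref 'global Hopf bifurcation Navier-Stokes periodic solutions continuum': only LOCAL Hopf results for NS — Sattinger1971, Iooss, ChenPrice1996, Chen2024 doi:10.1016/j.jmaa.2024.12839 (refuter refuter-rreview-route-AnomalousDissipati-218e94b9-0, 2026-08-15T11:20:56Z; prior: doi:10.1007/bfb0082943 Fiedler1988 global Hopf bifurcation (analytic semigroups) — the engine, doi:10.2307/2373851 AlexanderYorke1978; doi:10.1016/0022-0396(82)90085-7 MalletParetYorke1982 snakes, arXiv:2009.12762 ArioliKoch2021 local CAP Hopf for planar NS; doi:10.1007/bf02100098 ChenPrice1996; doi:10.1007/bf00250178 Sattinger1971, arXiv:1804.00547 VanVeenKidaKawahara2006 numerical UPO continuati)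

History (route lifecycle, newest last):
- 2026-08-15T16:19:56Z · rev 4: restated BoundedSnakesAreLoud (stmt-AnomalousDissipation-1800), BoundedSnakeToZero (stmt-AnomalousDissipation-1801), Assembly (stmt-AnomalousDissipation-1803) — planner repair rev 4 (refuter objection on stmt-1800, reviews 2+3 of 2026-08-15, pre-authorised by kill criterion (ii)): BoundedSnakesAreLoud → BoundedS (planner-rbadge-AnomalousDissipation-HopfSnake-923ed930-g2-0)
- 2026-08-16T03:42:03Z · AUTO-CRUX (backfill): BoundedLoudSnake — hypotheses of the deciding theorem that nothing in the route derives are cruxes (operator:999:586464)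
- 2026-08-22T06:43:24Z · DORMANT — reconciler: no traction for 5.1 d (last activity statement-grounded at 2026-08-17T02:45:17Z); parked, not closed — `ledger route dormant route-AnomalousDissipat (operator:999:3709505)

sub-problem: AnomalousDissipation · status: dormant · opened planner-plancard-AnomalousDissipation-Anomalo-e4331994-0 2026-08-15T10:58:50Z · rev 7 · ledger route-AnomalousDissipation-HopfSnake
GENERATED by the gate from the ledger (D-0016/17). Provers cite these decls: `theorem foo : Summit.AnomalousDissipation.AnomalousDissipation.Theses.HopfSnake.<Decl> := …` in Summits/AnomalousDissipation/AnomalousDissipation/Theorems/<Name>.lean.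
-/

namespace Summit.AnomalousDissipation.AnomalousDissipation.Theses.HopfSnake

open scoped BigOperators Topology Manifold Classical MeasureTheory ProbabilityTheory Matrix InnerProductSpace ComplexConjugate ContinuousMap
open Filter Set Function TopologicalSpace MeasureTheory

attribute [summit_statement] _root_.AnomalousDissipation

open Literature.Turb

/-- item stmt-AnomalousDissipation-1802 · crux (kind.auto-crux: conjecture-grade) · rank 0 · open · by planner
why it might fail: X = BoundedSnakeToZero ∧ loud tail: dies if every snake of every f leaves through exits (a)-(c) at positive ν (the global-Hopf alternative permits it), if no escaping snake has sup E < ∞, or if bounded snakes laminarise in injection ⟨(f,u)⟩→0 as the planar sector must (Alexakis–Doering ε ≲ ν^{1/2}).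
sources: Fiedler1988, Kielhofer2012, AlexakisDoering2006PLA, VanVeenKidaKawahara2006
[target] Thesis X of route HopfSnake (idea card follow-the-snake-global-hopf-viscosity-axis): some
smooth steady div-free mean-zero f on T³ carries a bounded loud (d)-snake — a continuous family s ↦
(ν(s), u(s), p(s)) of mean-zero, time-periodic, energetically non-stationary classical solutions of
NS_{ν(s)}(f) reaching ν → 0⁺ with periods/enstrophies locally bounded at positive viscosity,
limsup-mean energies ≤ E, and mean dissipation ≥ ε > 0 at arbitrarily small ν(s). X ⇐
BoundedSnakeToZero ∧ BoundedSnakesAreLoud (instantiate) and X ⇒ CoherentStates.CoherentThesis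
(stmt-0218: pick s_j with ν(s_j) < 1/(j+1)) ⇒ AnomalousDissipation; both implications are checked in
the planner sketch (SketchAssembly.lean, rc 0). Why it might fail: see the three cruxes; the whole
line dies if every snake of every f dies at positive viscosity. Sources: Fiedler1988 (engine),
VanVeenKidaKawahara2006 (numerical snakes in ν). -/
@[route_item "route-AnomalousDissipation-HopfSnake", crux]
def BoundedLoudSnake : Prop :=
  ∃ f : UnitAddTorus (Fin 3) → EuclideanSpace ℝ (Fin 3), Literature.Analysis.FunctionSpaces.Torus.IsSmooth f ∧ Literature.Analysis.FunctionSpaces.Torus.IsDivFree f ∧ Literature.Analysis.FunctionSpaces.Torus.HasZeroMean f ∧ ∃ (ν : ℝ → ℝ) (u : ℝ → ℝ → UnitAddTorus (Fin 3) → EuclideanSpace ℝ (Fin 3)) (p : ℝ → ℝ → UnitAddTorus (Fin 3) → ℝ), (Continuous ν ∧ Continuous (fun q : ℝ × ℝ × UnitAddTorus (Fin 3) => u q.1 q.2.1 q.2.2) ∧ (∀ s, 0 < ν s ∧ Literature.Analysis.FunctionSpaces.Torus.IsClassicalNSSolutionOn Set.univ (ν s) (fun _ => f) (u s) (p s) ∧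 (∀ t, Literature.Analysis.FunctionSpaces.Torus.HasZeroMean (u s t)) ∧ (∃ T, 0 < T ∧ Function.Periodic (u s) T) ∧ (∃ t, Literature.Analysis.FunctionSpaces.Torus.kineticEnergy (u s t) ≠ Literature.Analysis.FunctionSpaces.Torus.kineticEnergy (u s 0))) ∧ (∀ ν₀, 0 < ν₀ → ∃ s, ν s < ν₀) ∧ (∀ ν₁, 0 < ν₁ → ∃ M, ∀ s, ν₁ ≤ ν s → (∃ T, 0 < T ∧ T ≤ M ∧ Function.Periodic (u s) T) ∧ ∀ t, Literature.Analysis.FunctionSpaces.Torus.gradNormSq (u s t) ≤ M)) ∧ (∃ E : ℝ, ∀ s, Literature.Analysis.FluidPDE.meanEnergy (u s) ≤ E) ∧ ∃ ε : ℝ, 0 < ε ∧ ∀ ν₀, 0 < ν₀ → ∃ s, ν s < ν₀ ∧ ε ≤ Literature.Analysis.FluidPDE.meanDissipation (ν s) (u s)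

/-- item stmt-AnomalousDissipation-1799 · crux · rank 2 · open · by planner
why it might fail: Global Hopf yields a CONTINUUM whose alternative lets every snake exit at ν₁>0: return to steady states, virtual-period blow-up (flip cascades), or norm blow-up (excluding it needs the open 3-D bound PeriodicOrbitsEnstrophyBound); a continuous ARC is only generic (snakes): genericity in f unproved.
sources: Fiedler1988, Kielhofer2012, Ize1976, MalletParetYorke1982, AlexanderYorke1978, ChowMalletParetYorke1978
[crux] A (d)-SNAKE EXISTS (the milestone the engine must deliver): for some smooth steady div-free
mean-zero f on T³ there is a continuous one-parameter family s ↦ (ν(s), u(s), p(s)), s ∈ ℝ (ν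
continuous, (s,t,x) ↦ u(s,t,x) jointly continuous), of mean-zero, time-periodic, ENERGETICALLY
NON-STATIONARY (t ↦ ½∫|u(s,t)|² not constant: excludes steady states and travelling waves, which for
x₁-invariant f are steady states in a Galilean frame and belong to the steady routes) classical
solutions of NS_{ν(s)}(f) on ℝ × T³, with inf_s ν(s) = 0 and, for every ν₁ > 0, some period ≤ M and
enstrophy ≤ M uniformly on {s : ν(s) ≥ ν₁} (no exit (b) period blow-up, no exit (c) norm blow-up at
positive viscosity). 'Some period ≤ M' (not the minimal one) survives flip doublings; witnesses
extend evenly to s < 0. ENGINE: global Hopf bifurcation with λ = log(1/ν) as parameter — Fiedler1988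
Thm 2.10 + Cor 2.13 (analytic semigroups) + Rem 2.11, the PDE form of AlexanderYorke1978 /
ChowMalletParetYorke1978 (Fuller index) / MalletParetYorke1982 (snakes: oriented 1-manifolds whose
only ends are Hopf points): from a steady centre of non-zero global Hopf index a continuum of
periodic orbits emanates that is u -/
@[route_item "route-AnomalousDissipation-HopfSnake"]
def SnakeToZero : Prop :=
  ∃ f : UnitAddTorus (Fin 3) → EuclideanSpace ℝ (Fin 3), Literature.Analysis.FunctionSpaces.Torus.IsSmooth f ∧ Literature.Analysis.FunctionSpaces.Torus.IsDivFree f ∧ Literature.Analysis.FunctionSpaces.Torus.HasZeroMean f ∧ ∃ (ν : ℝ → ℝ) (u : ℝ → ℝ → UnitAddTorus (Fin 3) → EuclideanSpace ℝ (Fin 3)) (p : ℝ → ℝ → UnitAddTorus (Fin 3) → ℝ), Continuous ν ∧ Continuous (fun q : ℝ × ℝ × UnitAddTorus (Fin 3) => u q.1 q.2.1 q.2.2) ∧ (∀ s, 0 < ν s ∧ Literature.Analysis.FunctionSpaces.Torus.IsClassicalNSSolutionOn Set.univ (ν s) (fun _ => f) (u s) (p s) ∧ (∀ t, Literature.Analysis.FunctionSpaces.Torus.HasZeroMean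 (u s t)) ∧ (∃ T, 0 < T ∧ Function.Periodic (u s) T) ∧ (∃ t, Literature.Analysis.FunctionSpaces.Torus.kineticEnergy (u s t) ≠ Literature.Analysis.FunctionSpaces.Torus.kineticEnergy (u s 0))) ∧ (∀ ν₀, 0 < ν₀ → ∃ s, ν s < ν₀) ∧ (∀ ν₁, 0 < ν₁ → ∃ M, ∀ s, ν₁ ≤ ν s → (∃ T, 0 < T ∧ T ≤ M ∧ Function.Periodic (u s) T) ∧ ∀ t, Literature.Analysis.FunctionSpaces.Torus.gradNormSq (u s t) ≤ M)

/-- item stmt-AnomalousDissipation-10639 · crux · rank 3 · open · by planner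
why it might fail: Even for genuinely 3-D f nothing monotone keeps the injection ⟨(f,u(s))⟩ from → 0 along a bounded snake (force–velocity decorrelation); forces δ-close to planar ones may carry near-planar bounded snakes with ε(δ) → 0; ONE bounded quiet 3-D snake (certified UPO continuation) refutes it.
sources: AlexakisDoering2006PLA, Literature.Barriers.AnomalousDissipation.AlexakisDoering2006_energyDissipationBound, DoeringFoias2002, VanVeenKidaKawahara2006, ConstantinTarfuleaVicol2013, MalletParetYorke1982
[crux] BOUNDED (d)-SNAKES OF GENUINELY THREE-DIMENSIONAL FORCES ARE LOUD — rev-4 repaired form of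
stmt-1800 after the refuter objection (route reviews 2 and 3, 2026-08-15): the universal statement
is restricted to forces f with NO CONTINUOUS TRANSLATION SYMMETRY (∀ k ≠ 0 ∃ τ x, f (x + proj (τ•k))
≠ f x: f does not factor through a 2-torus quotient in any, possibly oblique, direction). This
removes exactly the x₃-independent (planar and 2.5-D) sector in which the PROVED barrier
AlexakisDoering2006_energyDissipationBound (ε ≲ U^{5/2}ν^{1/2}) makes bounded snakes quiet and the
old statement true-only-if-vacuous; and since a solution invariant under a one-parameter translation
group forces f to be invariant too (subtract the shifted momentum equation: the pressure difference
is harmonic on T³, hence constant), no snake of such an f lives in a planar invariant subspace.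
Content otherwise as 1800: for every such smooth steady div-free mean-zero f and every (d)-snake
exactly as in SnakeToZero whose limsup-mean energies ⟨‖u(s)‖²⟩ are bounded uniformly in s there is ε
> 0 with mean dissipation ν(s)⟨‖∇u(s)‖²⟩ ≥ ε at arbitrarily small ν(s) (⟨·⟩ = limsup of Cesàro means
= period mean for perio -/
@[route_item "route-AnomalousDissipation-HopfSnake"]
def BoundedSnakesAreLoud3D : Prop :=
  ∀ f : UnitAddTorus (Fin 3) → EuclideanSpace ℝ (Fin 3), Literature.Analysis.FunctionSpaces.Torus.IsSmooth f → Literature.Analysis.FunctionSpaces.Torus.IsDivFree f → Literature.Analysis.FunctionSpaces.Torus.HasZeroMean f → (∀ k : EuclideanSpace ℝ (Fin 3), k ≠ 0 → ∃ τ : ℝ, ∃ x, f (x + Literature.Analysis.FunctionSpaces.Torus.proj (τ • k)) ≠ f x) → ∀ (ν : ℝ → ℝ) (u : ℝ → ℝ → UnitAddTorus (Fin 3) → EuclideanSpace ℝ (Fin 3)) (p : ℝ → ℝ → UnitAddTorus (Fin 3) → ℝ), (Continuous ν ∧ Continuous (fun q : ℝ × ℝ × UnitAddTorus (Fin 3)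 => u q.1 q.2.1 q.2.2) ∧ (∀ s, 0 < ν s ∧ Literature.Analysis.FunctionSpaces.Torus.IsClassicalNSSolutionOn Set.univ (ν s) (fun _ => f) (u s) (p s) ∧ (∀ t, Literature.Analysis.FunctionSpaces.Torus.HasZeroMean (u s t)) ∧ (∃ T, 0 < T ∧ Function.Periodic (u s) T) ∧ (∃ t, Literature.Analysis.FunctionSpaces.Torus.kineticEnergy (u s t) ≠ Literature.Analysis.FunctionSpaces.Torus.kineticEnergy (u s 0))) ∧ (∀ ν₀, 0 < ν₀ → ∃ s, ν s < ν₀) ∧ (∀ ν₁, 0 < ν₁ → ∃ M, ∀ s, ν₁ ≤ ν s → (∃ T, 0 < T ∧ T ≤ M ∧ Function.Periodic (u s) T) ∧ ∀ t, Literature.Analysis.FunctionSpaces.Torus.gradNormSq (u s t) ≤ M)) → (∃ E : ℝ, ∀ s, Literature.Analysis.FluidPDE.meanEnergy (u s) ≤ E) → ∃ ε : ℝ, 0 < ε ∧ ∀ ν₀, 0 < ν₀ → ∃ s, ν s < ν₀ ∧ ε ≤ Literature.Analysis.FluidPDE.meanDissipation (ν s) (u s)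

/-- item stmt-AnomalousDissipation-17647 · crux · rank 3 · open · by planner
why it might fail: Scale-free core of 10639: a bounded snake of a 3-D force may laminarise with C_ε=ε/U³→0 — mean flow decorrelates from f while Reynolds stresses carry the momentum balance (planar mechanism; DNS hints C_ε decays slowly without walls); near-planar forces; one certified quiet bounded 3-D snake kills it
sources: DoeringFoias2002, CheskidovDoeringPetrov2006, Cheskidov2023, Frisch1995, AlexakisDoering2006PLA, IyerDrivasEyinkSreenivasan2025
[crux] BOUNDED SNAKES OF GENUINELY THREE-DIMENSIONAL FORCES SATURATE THE DOERING–FOIAS BOUND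
(Kolmogorov's dimensionless dissipation law along the snake; piece 2 of the typed decomposition of
BoundedLoudSnake): for every smooth steady div-free mean-zero f with no continuous translation
symmetry and every bounded (d)-snake (hypotheses verbatim as in BoundedSnakesAreLoud3D) there is β >
0 with ε(s) ≥ β·U(s)³ at arbitrarily small ν(s), where ε(s) = meanDissipation (ν s) (u s) =
⟨ν‖∇u(s)‖²⟩ and U(s) = rmsVelocity longTimeAvgSup (u s) = ⟨‖u(s)‖²⟩^{1/2} — i.e. the dissipation
coefficient C_ε = εℓ/U³ (ℓ = 1, Frisch 1995 §5.2; Doering–Foias 2002 prove C_ε ≤ c₁ + c₂/Re;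
Cheskidov 2023 Thm 1.3 attains c·U³ ≤ ε with ν-DEPENDENT forces) does not vanish along the tail.
STRICTLY WEAKER than BoundedSnakesAreLoud3D (stmt-10639: ε ≥ ε₀ and U² ≤ E give β = ε₀/E^{3/2}) and
scale-free: by itself it yields no dissipation floor (compatible with U(s) → 0). The converse
direction is the PROVED assembly (Theorems/HopfSnakeBoundedLoudSnakeSplit.lean,
boundedLoudSnake_of_pieces): the discharged Doering–Foias amplitude bound ‖f‖₂ ≤ aU² + bνU (momentum
equation tested against f) keeps U(s) ≥ (‖f‖₂/2a)^{1/2} on -/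
@[route_item "route-AnomalousDissipation-HopfSnake"]
def SnakesSaturateDoeringFoias3D : Prop :=
  ∀ f : UnitAddTorus (Fin 3) → EuclideanSpace ℝ (Fin 3), Literature.Analysis.FunctionSpaces.Torus.IsSmooth f → Literature.Analysis.FunctionSpaces.Torus.IsDivFree f → Literature.Analysis.FunctionSpaces.Torus.HasZeroMean f → (∀ k : EuclideanSpace ℝ (Fin 3), k ≠ 0 → ∃ τ : ℝ, ∃ x, f (x + Literature.Analysis.FunctionSpaces.Torus.proj (τ • k)) ≠ f x) → ∀ (ν : ℝ → ℝ) (u : ℝ → ℝ → UnitAddTorus (Fin 3) → EuclideanSpace ℝ (Fin 3)) (p : ℝ → ℝ → UnitAddTorus (Fin 3) → ℝ), (Continuous ν ∧ Continuous (fun q : ℝ × ℝ × UnitAddTorus (Fin 3) => u q.1 q.2.1 q.2.2) ∧ (∀ s, 0 < ν s ∧ Literature.Analysis.FunctionSpaces.Torus.IsClassicalNSSolutionOn Set.univ (ν s) (fun _ => f) (u s) (p s) ∧ (∀ t, Literature.Analysis.FunctionSpaces.Torus.HasZeroMean (u s t)) ∧ (∃ T, 0 < T ∧ Function.Periodic (u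 s) T) ∧ (∃ t, Literature.Analysis.FunctionSpaces.Torus.kineticEnergy (u s t) ≠ Literature.Analysis.FunctionSpaces.Torus.kineticEnergy (u s 0))) ∧ (∀ ν₀, 0 < ν₀ → ∃ s, ν s < ν₀) ∧ (∀ ν₁, 0 < ν₁ → ∃ M, ∀ s, ν₁ ≤ ν s → (∃ T, 0 < T ∧ T ≤ M ∧ Function.Periodic (u s) T) ∧ ∀ t, Literature.Analysis.FunctionSpaces.Torus.gradNormSq (u s t) ≤ M)) → (∃ E : ℝ, ∀ s, Literature.Analysis.FluidPDE.meanEnergy (u s) ≤ E) → ∃ β : ℝ, 0 < β ∧ ∀ ν₀, 0 < ν₀ → ∃ s, ν s < ν₀ ∧ β * Literature.Analysis.FluidPDE.rmsVelocity Literature.Analysis.FluidPDE.longTimeAvgSup (u s) ^ 3 ≤ Literature.Analysis.FluidPDE.meanDissipation (ν s) (u s)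

/-- item stmt-AnomalousDissipation-10640 · crux · rank 4 · open · by planner
why it might fail: Strictly stronger than SnakeToZero (inherits exits (a)–(c)) plus selection: the only a-priori bound is laminar, ⟨‖u‖²⟩ ≲ ‖f‖²/ν²; no exact-solution family with sup E < ∞ as ν → 0 is known for any fixed f; the 3-D side condition excludes planar/2.5-D constructions.
sources: VanVeenKidaKawahara2006, VanVeenVelaMartinKawahara2019, DoeringFoias2002, Cheskidov2023, Fiedler1988, MalletParetYorke1982
[crux] A BOUNDED (d)-SNAKE OF A GENUINELY THREE-DIMENSIONAL FORCE EXISTS (selection) — rev-4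
repaired form of stmt-1801 matching BoundedSnakesAreLoud3D: SnakeToZero for a smooth steady div-free
mean-zero f with no continuous translation symmetry (∀ k ≠ 0 ∃ τ x, f (x + proj (τ•k)) ≠ f x;
generic f, Taylor–Green and Kida forcings qualify, Kolmogorov/shear forcings do not) with, in
addition, sup_s ⟨‖u(s)‖²⟩ < ∞ (limsup-mean energy, the summit's own functional meanEnergy). Among
the snakes escaping to ν → 0⁺ (net number = net Hopf spectral flow of the steady variety by
Fuller-index additivity) at least one must NOT follow the laminar scaling E ~ ν⁻²; evidence: UPOs
embedded in steadily forced box turbulence have O(1) energy and near-turbulent dissipation over the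
computed range (VanVeenKidaKawahara2006 = arXiv:1804.00547 p.7; VanVeenVelaMartinKawahara2019 =
arXiv:1809.08649). Logically STRONGER than 1801 (planner sketch: BoundedSnakeToZero3D →
BoundedSnakeToZero) and implies SnakeToZero; with BoundedSnakesAreLoud3D it yields the target
BoundedLoudSnake by instantiation and hence the summit via closes (Sketch3D.lean rc 0). -/
@[route_item "route-AnomalousDissipation-HopfSnake"]
def BoundedSnakeToZero3D : Prop :=
  ∃ f : UnitAddTorus (Fin 3) → EuclideanSpace ℝ (Fin 3), Literature.Analysis.FunctionSpaces.Torus.IsSmooth f ∧ Literature.Analysis.FunctionSpaces.Torus.IsDivFree f ∧ Literature.Analysis.FunctionSpaces.Torus.HasZeroMean f ∧ (∀ k : EuclideanSpace ℝ (Fin 3), k ≠ 0 → ∃ τ : ℝ, ∃ x, f (x + Literature.Analysis.FunctionSpaces.Torus.proj (τ • k)) ≠ f x) ∧ ∃ (ν : ℝ → ℝ) (u : ℝ → ℝ → UnitAddTorus (Fin 3) → EuclideanSpace ℝ (Fin 3)) (p : ℝ → ℝ → UnitAddTorus (Fin 3) → ℝ), (Continuous ν ∧ Continuous (fun q : ℝ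 × ℝ × UnitAddTorus (Fin 3) => u q.1 q.2.1 q.2.2) ∧ (∀ s, 0 < ν s ∧ Literature.Analysis.FunctionSpaces.Torus.IsClassicalNSSolutionOn Set.univ (ν s) (fun _ => f) (u s) (p s) ∧ (∀ t, Literature.Analysis.FunctionSpaces.Torus.HasZeroMean (u s t)) ∧ (∃ T, 0 < T ∧ Function.Periodic (u s) T) ∧ (∃ t, Literature.Analysis.FunctionSpaces.Torus.kineticEnergy (u s t) ≠ Literature.Analysis.FunctionSpaces.Torus.kineticEnergy (u s 0))) ∧ (∀ ν₀, 0 < ν₀ → ∃ s, ν s < ν₀) ∧ (∀ ν₁, 0 < ν₁ → ∃ M, ∀ s, ν₁ ≤ ν s → (∃ T, 0 < T ∧ T ≤ M ∧ Function.Periodic (u s) T) ∧ ∀ t, Literature.Analysis.FunctionSpaces.Torus.gradNormSq (u s t) ≤ M)) ∧ ∃ E : ℝ, ∀ s, Literature.Analysis.FluidPDE.meanEnergy (u s) ≤ E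

/-- item stmt-AnomalousDissipation-14104 · support · rank 9 · closed · proved by Summit.AnomalousDissipation.AnomalousDissipation.Theorems.loudSnakeGlue_proof (prover) · by planner
[support] TARGET GLUE of the two rev-4 cruxes into the target X (route-choice repair 2026-08-16,
answers the gate hold route.target-unreachable 'no item concludes the target BoundedLoudSnake'):
BoundedSnakeToZero3D → BoundedSnakesAreLoud3D → BoundedLoudSnake. Take the genuinely
three-dimensional force f and its bounded (d)-snake (ν, u, p) with energy bound E from
BoundedSnakeToZero3D, instantiate the universal loudness crux BoundedSnakesAreLoud3D at (f, ν, u, p)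
to get ε > 0 with mean dissipation ≥ ε at arbitrarily small ν(s), and repackage as BoundedLoudSnake
(the 3-D side condition is simply forgotten). Pure logic, PROVED in the planner sketch Sketch.lean
(2 lines: rintro ⟨f, hf, hdiv, hmean, h3d, ν, u, p, hsnake, hE⟩ hloud; exact ⟨f, hf, hdiv, hmean, ν,
u, p, hsnake, hE, hloud f hf hdiv hmean h3d ν u p hsnake hE⟩; lean check rc 0, axioms
propext/Classical.choice/Quot.sound); with the certified deciding theorem closes : BoundedLoudSnake
→ AnomalousDissipation it also yields the Assembly item. Provable now by any idle prover. Sources: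
route file HopfSnake.lean rev 5 (items stmt-AnomalousDissipation-10639, -10640, -1802); precedent
BaireTransfer.DensityGlue. -/
@[route_item "route-AnomalousDissipation-HopfSnake"]
def LoudSnakeGlue : Prop :=
  BoundedSnakeToZero3D → BoundedSnakesAreLoud3D → BoundedLoudSnake

/-- item stmt-AnomalousDissipation-17863 · support · rank 9 · open · by planner
[support] GLUE OF THE TYPED DECOMPOSITION of the deciding crux BoundedLoudSnake (stmt-1802; BC2
redirect by the crux-strategist, 2026-08-17): BoundedSnakeToZero3D → SnakesSaturateDoeringFoias3D →
BoundedLoudSnake. NOT an instantiation seam (contrast LoudSnakeGlue): piece 2 is Kolmogorov's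
DIMENSIONLESS law ε(s) ≥ βU(s)³ (cofinally), which gives no dissipation floor by itself; the glue
supplies the Doering–Foias lower bound on the r.m.s. velocity for a FIXED non-zero force — (1) the
3-D side condition forces f ≠ 0, so F = ‖f‖₂ > 0 (a smooth field with ∫‖f‖² = 0 vanishes); (2) Φ =
f/F is a Doering–Foias forcing shape with Φ.force 1 F = f; (3) each snake member is a global
Leray–Hopf solution (discharged isGlobalLerayHopf_of_isClassicalNSSolutionOn), so the DISCHARGED
amplitude bound DoeringFoias2002_amplitude_le_holds (Cheskidov–Doering–Petrov 2007 (18)–(19):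
momentum equation tested against the force, integration by parts, time average) gives F ≤ aU(s)² +
bν(s)U(s); (4) with U(s)² ≤ max E 1 =: R², for ν(s) < F/(2bR): U(s) ≥ (F/2a)^{1/2} =: U_m > 0; (5)
the law at threshold min ν₀ (F/2bR) gives s with ν(s) < ν₀ and ε(s) ≥ βU(s)³ ≥ βU_m³ =: ε₀. PROVED
AND PROVABLE NOW: planner file Cr -/
@[route_item "route-AnomalousDissipation-HopfSnake"]
def BoundedLoudSnakeOfPieces : Prop :=
  BoundedSnakeToZero3D → SnakesSaturateDoeringFoias3D → BoundedLoudSnake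

/-- item stmt-AnomalousDissipation-1804 · support · rank 9 · open · by planner
sources: ConstantinFoias1988, FoiasManleyRosaTemam2001, Fiedler1988
[support] EXIT (c) KILLER — the precise conditional-regularity input the engine consumes: at FIXED ν
> 0 and smooth steady div-free mean-zero f, mean-zero time-periodic classical solutions of NS_ν(f)
with kinetic energy ≤ R for all t have enstrophy ‖∇u(t)‖² ≤ C(ν, f, R) for all t, uniformly over all
such solutions and all periods. Periodic solutions are bounded eternal trajectories, i.e. lie on the
(weak) global attractor; the statement says its periodic part is bounded in H¹ on energy sublevels.
It is what turns Fiedler's alternative 'unbounded in X^ω at bounded λ' into exit (b) only (with the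
period bound, H¹ ⇒ H^{2ω} by parabolic smoothing over one period). Why it might fail: open even
granting global regularity (no uniformity over all periodic solutions follows); in 3-D only the
small-data / large-ν uniqueness regime is covered (ConstantinFoias1988 Ch. 9–10;
FoiasManleyRosaTemam2001 Ch. III); a refutation at one ν makes SnakeToZero conditional on it. The
2-D analogue is true (enstrophy balance + Ladyzhenskaya). -/
@[route_item "route-AnomalousDissipation-HopfSnake"]
def PeriodicOrbitsEnstrophyBound : Prop :=
  ∀ ν : ℝ, 0 < ν → ∀ f : UnitAddTorus (Fin 3) → EuclideanSpace ℝ (Fin 3), Literature.Analysis.FunctionSpaces.Torus.IsSmooth f → Literature.Analysis.FunctionSpaces.Torus.IsDivFree f → Literature.Analysis.FunctionSpaces.Torus.HasZeroMean f → ∀ R : ℝ, ∃ C : ℝ, ∀ (u : ℝ → UnitAddTorus (Fin 3) → EuclideanSpace ℝ (Fin 3)) (p : ℝ → UnitAddTorus (Fin 3) → ℝ) (T : ℝ), Literature.Analysis.FunctionSpaces.Torus.IsClassicalNSSolutionOn Set.univ ν (fun _ => f) u p → (∀ t, Literature.Analysis.FunctionSpaces.Torus.HasZeroMean (u t)) →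 0 < T → Function.Periodic u T → (∀ t, Literature.Analysis.FunctionSpaces.Torus.kineticEnergy (u t) ≤ R) → ∀ t, Literature.Analysis.FunctionSpaces.Torus.gradNormSq (u t) ≤ C

-- item stmt-AnomalousDissipation-1888 · support · rank 9 · open · by planner — informal only, no Lean statement yet:
--   [support] THE ENGINE, informal until the linearised NS operator / crossing numbers exist in
--   Literature (definition requested; then set-signature): Fiedler1988 Thm 2.10 with Cor 2.13 (analytic
--   semigroups d_t x = A(λ)x + f(λ,x): A(λ) sectorial with compact resolvent and λ-independent domain, f
--   ∈ C⁴(Λ × X^ω, X)) and Remark 2.11 (work in an open region Y ⊆ Λ × X^ω avoiding degenerate steady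
--   states), no symmetry (Γ trivial), instantiated for d_t u = −νAu − B(u,u) + f on L²_{σ,0}(T³) (A =
--   Stokes operator, B(u,u) = P(u·∇u), X^ω = D(A^ω) = H^{2ω}_{σ,0} with ω ∈ (3/4, 1) so that B : X^ω ×
--   X^ω → L² is b

-- earlier Assembly (stmt-AnomalousDissipation-1803, replaced 2026-08-15T16:19:56Z -> stmt-AnomalousDissipation-10641): retired by None — BoundedSnakeToZero → BoundedSnakesAreLoud → Literature.Analysis.FluidPDE.Torus.isGlobalLerayHopf_of_isClassicalNSSolutionOn → AnomalousDissipation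
/-- item stmt-AnomalousDissipation-10641 · assembly · rank 1 · closed · proved by Summit.AnomalousDissipation.AnomalousDissipation.Theorems.hopfSnakeAssembly_proof (prover) · by planner
sources: RobinsonRodrigoSadowski2016, Galdi2000, DoeringFoias2002
[assembly] BoundedSnakeToZero3D → BoundedSnakesAreLoud3D → AnomalousDissipation: instantiate the
loudness crux on the bounded snake of a genuinely three-dimensional force to obtain the target
BoundedLoudSnake, then apply the route's certified deciding theorem closes : BoundedLoudSnake →
AnomalousDissipation (rev 3; Leray–Hopf-ness of the classical snake solutions by the discharged fact
Torus.isGlobalLerayHopf_of_isClassicalNSSolutionOn_holds). Pure logic given closes; provable now in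
~10 lines (planner sketch Sketch3D.lean, rc 0, axioms propext/Classical.choice/Quot.sound). Replaces
the rev-2 Assembly BoundedSnakeToZero → BoundedSnakesAreLoud →
isGlobalLerayHopf_of_isClassicalNSSolutionOn → AnomalousDissipation, whose unlisted Literature-fact
antecedent raised glue.extra-hypothesis. -/
@[route_item "route-AnomalousDissipation-HopfSnake"]
def Assembly : Prop :=
  BoundedSnakeToZero3D → BoundedSnakesAreLoud3D → _root_.AnomalousDissipation

-- records of items no longer active in this route (dropped / restated):
-- earlier BoundedSnakesAreLoud (stmt-AnomalousDissipation-1800, replaced 2026-08-15T16:19:56Z -> stmt-AnomalousDissipation-10639): retired by None — ∀ f : UnitAddTorus (Fin 3) → EuclideanSpace ℝ (Fin 3), Literature.Analysis.FunctionSpaces.Torus.IsSmooth f → Literature.Analysis.FunctionSpaces.Torus.IsDivFree f → Literature.Analysis.FunctionSpaces.Torus.HasZeroMean f → ∀ (ν : ℝ → ℝ) (u : ℝ → ℝ → UnitA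
-- earlier BoundedSnakeToZero (stmt-AnomalousDissipation-1801, replaced 2026-08-15T16:19:56Z -> stmt-AnomalousDissipation-10640): retired by None — ∃ f : UnitAddTorus (Fin 3) → EuclideanSpace ℝ (Fin 3), Literature.Analysis.FunctionSpaces.Torus.IsSmooth f ∧ Literature.Analysis.FunctionSpaces.Torus.IsDivFree f ∧ Literature.Analysis.FunctionSpaces.Torus.HasZeroMean f ∧ ∃ (ν : ℝ → ℝ) (u : ℝ → ℝ → UnitAdd

/-! D-0027 §2.1 — DECIDING THEOREM (planner-authored via `route open/edit --closes-file`; by planner-rbadge-AnomalousDissipation-HopfSnake-923ed930-g2-0 2026-08-15T16:19:55Z):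
its hypotheses are this route's items and its conclusion the sub-problem Statement (glue_lint), and it elaborates with this file. -/

@[closes "route-AnomalousDissipation-HopfSnake"] theorem closes : BoundedLoudSnake → _root_.AnomalousDissipation := by
  -- X = BoundedLoudSnake gives one force f and a bounded loud (d)-snake s ↦ (ν s, u s, p s);
  -- choose s_j with ν (s_j) < 1/(j+1) and mean dissipation ≥ ε, so ν_j → 0 by squeezing;
  -- each u (s_j) is a global classical solution at ν (s_j) > 0, hence a global Leray–Hopf
  -- solution from its own datum u (s_j) 0 by the DISCHARGED Literature fact
  -- `Torus.isGlobalLerayHopf_of_isClassicalNSSolutionOn` (used through its proof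
  -- `IsClassicalNSSolutionOn.isGlobalLerayHopf`, TorusClassicalLerayHopfProofs) — nothing assumed.
  rintro ⟨f, hf, hdiv, hmean, ν, u, p, ⟨-, -, hsol, -, -⟩, ⟨E, hE⟩, ε, hε, hloud⟩
  choose s hs using fun j : ℕ => hloud (1 / ((j : ℝ) + 1)) (by positivity)
  exact ⟨f, hf, hdiv, hmean, fun j => ν (s j), fun j => u (s j) 0, fun j => u (s j),
    fun j => (hsol (s j)).1,
    squeeze_zero (fun j => (hsol (s j)).1.le) (fun j => (hs j).1.le)
      tendsto_one_div_add_atTop_nhds_zero_nat,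
    fun j => (hsol (s j)).2.1.isGlobalLerayHopf, ⟨E, fun j => hE (s j)⟩, ε, hε, fun j => (hs j).2⟩

end Summit.AnomalousDissipation.AnomalousDissipation.Theses.HopfSnake
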